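import Summits.QuantumFields.YangMills.Theorems.ParabolicTrajectoryLatticeGapOnTrajectoryStubWilsonTorusDLR
import HarnessLib

/-!
# Crux `LatticeGapOnTrajectory` (stmt-QuantumFields-10523), line `orbit-kantorovich-finite-size`:
# Gibbs-ratio perturbation and the Lipschitz bound of the plaquette cost (slab clustering, part 1)

Helper file (`--supports stmt-QuantumFields-10523`) for the registered stub `stub_slabClustering`
(G-blind plumbing towards the TV-Lipschitz bound of Wilson's torus kernels; nothing about mass gaps
is asserted, everything here is proved).

* §1 An abstract perturbation bound for Gibbs ratios `∫ e^u F dπ / ∫ e^u dπ` (`π` a probability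
  measure) under a change of the energy `u ↦ u'` with `|u − u'| ≤ a`: `≤ 2B(e^{2a} − 1)`
  (`abs_gibbsRatio_sub_le`), and the linearised form `≤ 4e² B a` (`abs_gibbsRatio_sub_le_linear`,
  the registered helper).
* §2 The representation distance `repDist` and the Lipschitz bound of one plaquette cost
  `N − Re tr ρ(U_p)` in its four link variables (`abs_plaquetteCost_sub_le`; unitarity of `ρ`:
  `|Re tr (X ρ(g))| ≤ Σ|X_{ij}|`), the change of the Wilson action under a linkwise `s`-close
  modification supported on an edge set `Y` (`abs_wilsonAction_sub_le`: `≤ 4·#{plaquettes based in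
  the shadow of Y}·s`), and two small locality facts (plaquette costs, gauge transformations).

References: Georgii 2011 §8.2 (tilting / Künsch covariance step); Seiler LNP 159 Ch. 1 (Wilson
action); Dobrushin–Shlosman 1985 (role of the one-cell total-variation bound).
-/

namespace Summit.QuantumFields.YangMills.Cruxes.LatticeGapOnTrajectory.OrbitKantorovichFiniteSize

open scoped BigOperators ENNReal
open Filter MeasureTheory
open Literature.Probability.LatticeModels (Specification glueWith glueWith_apply_mem
  glueWith_apply_not_mem measurable_glueWith)
open Literature.MathematicalPhysics.QuantumFieldTheory

noncomputable section

namespace SlabClustering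

/-! ### §1 Perturbation of Gibbs ratios -/

section Perturb

variable {Z : Type*} [MeasurableSpace Z] (π : Measure Z) [IsProbabilityMeasure π]

/-- A bounded measurable real function is integrable against a probability measure. -/
theorem integrable_of_abs_le {F : Z → ℝ} (hF : Measurable F) {B : ℝ} (hFb : ∀ z, |F z| ≤ B) :
    Integrable F π :=
  Integrable.of_bound hF.aestronglyMeasurable B (ae_of_all _ fun z => by
    rw [Real.norm_eq_abs]; exact hFb z)

/-- The Boltzmann factor of a bounded measurable energy is integrable and bounded by `e^{C}`. -/
theorem integrable_exp_of_abs_le {u : Z → ℝ} (hu : Measurable u) {C : ℝ} (hub : ∀ z, |u z| ≤ C) :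
    Integrable (fun z => Real.exp (u z)) π :=
  integrable_of_abs_le π hu.exp fun z => by
    rw [Real.abs_exp]; exact Real.exp_le_exp.2 ((le_abs_self _).trans (hub z))

/-- A Gibbs ratio of a function bounded by `B` is bounded by `B`. -/
theorem abs_gibbsRatio_le {u F : Z → ℝ} (hu : Measurable u) (hF : Measurable F) {C B : ℝ}
    (hub : ∀ z, |u z| ≤ C) (hFb : ∀ z, |F z| ≤ B) :
    |(∫ z, Real.exp (u z) * F z ∂π) / ∫ z, Real.exp (u z) ∂π| ≤ B := by
  have hint := integrable_exp_of_abs_le π hu hub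
  have hZ : 0 < ∫ z, Real.exp (u z) ∂π := integral_exp_pos hint
  have hB : 0 ≤ B := by
    obtain ⟨z⟩ : Nonempty Z := nonempty_of_isProbabilityMeasure π
    exact (abs_nonneg _).trans (hFb z)
  have h1 : |∫ z, Real.exp (u z) * F z ∂π| ≤ B * ∫ z, Real.exp (u z) ∂π := by
    rw [← integral_const_mul]
    refine (abs_integral_le_integral_abs (μ := π) (f := fun z => Real.exp (u z) * F z)).trans
      (integral_mono ?_ (hint.const_mul B) fun z => ?_)
    · exact (integrable_of_abs_le π (F := fun z => Real.exp (u z) * F z) (hu.exp.mul hF)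
        (B := Real.exp C * B) fun z => by
        rw [abs_mul, Real.abs_exp]
        exact mul_le_mul (Real.exp_le_exp.2 ((le_abs_self _).trans (hub z))) (hFb z)
          (abs_nonneg _) (Real.exp_pos _).le).abs
    · show |Real.exp (u z) * F z| ≤ B * Real.exp (u z)
      rw [abs_mul, Real.abs_exp, mul_comm]
      exact mul_le_mul_of_nonneg_right (hFb z) (Real.exp_pos _).le
  rw [abs_div, abs_of_pos hZ, div_le_iff₀ hZ]
  exact h1

/-- **Perturbation of a Gibbs ratio.** If two bounded measurable energies differ by at most `a`
pointwise, the Gibbs expectations of a function bounded by `B` differ by at most `2B(e^{2a} − 1)`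
(the two normalised densities are within a factor `e^{±2a}` of each other). -/
theorem abs_gibbsRatio_sub_le {u u' F : Z → ℝ} (hu : Measurable u) (hu' : Measurable u')
    (hF : Measurable F) {C B a : ℝ} (hub : ∀ z, |u z| ≤ C) (hub' : ∀ z, |u' z| ≤ C)
    (hFb : ∀ z, |F z| ≤ B) (ha : ∀ z, |u z - u' z| ≤ a) :
    |(∫ z, Real.exp (u z) * F z ∂π) / (∫ z, Real.exp (u z) ∂π) -
        (∫ z, Real.exp (u' z) * F z ∂π) / ∫ z, Real.exp (u' z) ∂π| ≤
      2 * B * (Real.exp (2 * a) - 1) := by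
  obtain ⟨z₀⟩ : Nonempty Z := nonempty_of_isProbabilityMeasure π
  have hB : 0 ≤ B := (abs_nonneg _).trans (hFb z₀)
  have ha0 : 0 ≤ a := (abs_nonneg _).trans (ha z₀)
  have hint := integrable_exp_of_abs_le π hu hub
  have hint' := integrable_exp_of_abs_le π hu' hub'
  set Z₁ := ∫ z, Real.exp (u z) ∂π with hZ₁
  set Z₂ := ∫ z, Real.exp (u' z) ∂π with hZ₂
  have hZ₁pos : 0 < Z₁ := integral_exp_pos hint
  have hZ₂pos : 0 < Z₂ := integral_exp_pos hint'
  -- pointwise comparison of the Boltzmann factors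
  have hpt : ∀ z, Real.exp (u' z) ≤ Real.exp a * Real.exp (u z) := fun z => by
    rw [← Real.exp_add, Real.exp_le_exp]; linarith [(abs_le.1 (ha z)).1]
  have hpt' : ∀ z, Real.exp (u z) ≤ Real.exp a * Real.exp (u' z) := fun z => by
    rw [← Real.exp_add, Real.exp_le_exp]; linarith [(abs_le.1 (ha z)).2]
  have hZ₂₁ : Z₂ ≤ Real.exp a * Z₁ := by
    rw [hZ₁, ← integral_const_mul]
    exact integral_mono hint' (hint.const_mul _) hpt
  have hZ₁₂ : Z₁ ≤ Real.exp a * Z₂ := by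
    rw [hZ₂, ← integral_const_mul]
    exact integral_mono hint (hint'.const_mul _) hpt'
  -- the two normalised densities
  set p : Z → ℝ := fun z => Real.exp (u z) / Z₁ with hp
  set p' : Z → ℝ := fun z => Real.exp (u' z) / Z₂ with hp'
  have hea : Real.exp a * Real.exp a = Real.exp (2 * a) := by rw [← Real.exp_add]; ring_nf
  have hpp' : ∀ z, p' z ≤ Real.exp (2 * a) * p z := fun z => by
    simp only [hp, hp']
    calc Real.exp (u' z) / Z₂ ≤ (Real.exp a * Real.exp (u z)) / (Z₁ / Real.exp a) :=
          div_le_div₀ (by positivity) (hpt z) (by positivity)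
            ((div_le_iff₀ (Real.exp_pos a)).2 (by rw [mul_comm]; exact hZ₁₂))
      _ = Real.exp (2 * a) * (Real.exp (u z) / Z₁) := by
          rw [← hea]; field_simp
  have hp'p : ∀ z, p z ≤ Real.exp (2 * a) * p' z := fun z => by
    simp only [hp, hp']
    calc Real.exp (u z) / Z₁ ≤ (Real.exp a * Real.exp (u' z)) / (Z₂ / Real.exp a) :=
          div_le_div₀ (by positivity) (hpt' z) (by positivity)
            ((div_le_iff₀ (Real.exp_pos a)).2 (by rw [mul_comm]; exact hZ₂₁))
      _ = Real.exp (2 * a) * (Real.exp (u' z) / Z₂) := by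
          rw [← hea]; field_simp
  have hp0 : ∀ z, 0 ≤ p z := fun z => by positivity
  have hp'0 : ∀ z, 0 ≤ p' z := fun z => by positivity
  have hdiff : ∀ z, |p z - p' z| ≤ (Real.exp (2 * a) - 1) * (p z + p' z) := fun z => by
    have h1 := hpp' z
    have h2 := hp'p z
    have he : 0 ≤ Real.exp (2 * a) - 1 := by linarith [Real.one_le_exp (by linarith : 0 ≤ 2 * a)]
    rw [abs_sub_le_iff]
    constructor <;> nlinarith [hp0 z, hp'0 z]
  -- integrability bookkeeping
  have hpi : Integrable p π := hint.div_const _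
  have hp'i : Integrable p' π := hint'.div_const _
  have hFi : ∀ {g : Z → ℝ}, Integrable g π → Integrable (fun z => F z * g z) π := fun hg =>
    hg.bdd_mul hF.aestronglyMeasurable (ae_of_all _ fun z => by rw [Real.norm_eq_abs]; exact hFb z)
  have hintp : ∫ z, p z ∂π = 1 := by
    simp only [hp]; rw [integral_div, hZ₁]; exact div_self hZ₁pos.ne'
  have hintp' : ∫ z, p' z ∂π = 1 := by
    simp only [hp']; rw [integral_div, hZ₂]; exact div_self hZ₂pos.ne'
  -- the difference of the two ratios as one integral
  have hrepr : (∫ z, Real.exp (u z) * F z ∂π) / Z₁ - (∫ z, Real.exp (u' z) * F z ∂π) / Z₂ =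
      ∫ z, F z * (p z - p' z) ∂π := by
    rw [← integral_div, ← integral_div, ← integral_sub]
    · refine integral_congr_ae (ae_of_all _ fun z => ?_)
      simp only [hp, hp']; ring
    · simpa [hp, mul_comm, mul_div_assoc] using hFi hpi
    · simpa [hp', mul_comm, mul_div_assoc] using hFi hp'i
  rw [hrepr]
  calc |∫ z, F z * (p z - p' z) ∂π| ≤ ∫ z, |F z * (p z - p' z)| ∂π := abs_integral_le_integral_abs
    _ ≤ ∫ z, B * ((Real.exp (2 * a) - 1) * (p z + p' z)) ∂π := by
        refine integral_mono (hFi (hpi.sub hp'i)).abs (((hpi.add hp'i).const_mul _).const_mul _)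
          fun z => ?_
        show |F z * (p z - p' z)| ≤ B * ((Real.exp (2 * a) - 1) * (p z + p' z))
        rw [abs_mul]
        exact mul_le_mul (hFb z) (hdiff z) (abs_nonneg _) hB
    _ = 2 * B * (Real.exp (2 * a) - 1) := by
        rw [integral_const_mul, integral_const_mul, integral_add hpi hp'i, hintp, hintp']; ring

/-- **Linearised perturbation bound**: under the hypotheses of `abs_gibbsRatio_sub_le` the two Gibbs
ratios differ by at most `4e² B a` (for `a ≤ 1` use `e^{2a} − 1 ≤ 2a e²`, for `a > 1` the trivial
bound `2B`). -/
theorem abs_gibbsRatio_sub_le_linear {u u' F : Z → ℝ} (hu : Measurable u) (hu' : Measurable u')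
    (hF : Measurable F) {C B a : ℝ} (hub : ∀ z, |u z| ≤ C) (hub' : ∀ z, |u' z| ≤ C)
    (hFb : ∀ z, |F z| ≤ B) (ha : ∀ z, |u z - u' z| ≤ a) :
    |(∫ z, Real.exp (u z) * F z ∂π) / (∫ z, Real.exp (u z) ∂π) -
        (∫ z, Real.exp (u' z) * F z ∂π) / ∫ z, Real.exp (u' z) ∂π| ≤
      4 * Real.exp 2 * B * a := by
  obtain ⟨z₀⟩ : Nonempty Z := nonempty_of_isProbabilityMeasure π
  have hB : 0 ≤ B := (abs_nonneg _).trans (hFb z₀)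
  have ha0 : 0 ≤ a := (abs_nonneg _).trans (ha z₀)
  rcases le_or_gt a 1 with ha1 | ha1
  · refine (abs_gibbsRatio_sub_le π hu hu' hF hub hub' hFb ha).trans ?_
    -- `e^{2a} - 1 ≤ 2a e^{2a} ≤ 2a e²`
    have h1 : Real.exp (2 * a) - 1 ≤ 2 * a * Real.exp (2 * a) := by
      have h := Real.add_one_le_exp (-(2 * a))
      have h' : Real.exp (-(2 * a)) * Real.exp (2 * a) = 1 := by rw [← Real.exp_add]; simp
      nlinarith [Real.exp_pos (2 * a), Real.exp_pos (-(2 * a))]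
    have h2 : Real.exp (2 * a) ≤ Real.exp 2 := Real.exp_le_exp.2 (by linarith)
    calc 2 * B * (Real.exp (2 * a) - 1) ≤ 2 * B * (2 * a * Real.exp 2) := by
          refine mul_le_mul_of_nonneg_left (h1.trans ?_) (by positivity)
          exact mul_le_mul_of_nonneg_left h2 (by positivity)
      _ = 4 * Real.exp 2 * B * a := by ring
  · calc _ ≤ |(∫ z, Real.exp (u z) * F z ∂π) / ∫ z, Real.exp (u z) ∂π| +
          |(∫ z, Real.exp (u' z) * F z ∂π) / ∫ z, Real.exp (u' z) ∂π| := abs_sub _ _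
      _ ≤ B + B := add_le_add (abs_gibbsRatio_le π hu hF hub hFb) (abs_gibbsRatio_le π hu' hF hub' hFb)
      _ ≤ 4 * Real.exp 2 * B * a := by
          have h1 : B ≤ B * a := le_mul_of_one_le_right hB ha1.le
          have h2 : B * a ≤ Real.exp 2 * (B * a) :=
            le_mul_of_one_le_left (by positivity) (Real.one_le_exp (by norm_num))
          linarith

end Perturb

/-! ### §2 The representation distance and the plaquette cost -/

section Rep

variable {G : Type} [Group G] [TopologicalSpace G] (r : LatticeRep G)

/-- `repDist ≥ 0`. -/
theorem repDist_nonneg (u v : G) : 0 ≤ repDist r u v :=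
  Finset.sum_nonneg fun _ _ => Finset.sum_nonneg fun _ _ => norm_nonneg _

/-- `repDist u u = 0`. -/
theorem repDist_self (u : G) : repDist r u u = 0 := by simp [repDist]

/-- `repDist` is symmetric. -/
theorem repDist_comm (u v : G) : repDist r u v = repDist r v u := by
  simp only [repDist, norm_sub_rev]

/-- Unitarity: `|Re tr (X ρ(g))| ≤ Σ_{ij} |X_{ij}|` (the entries of `ρ(g)` have modulus `≤ 1`). -/
theorem abs_trace_re_mul_rep_le (X : Matrix (Fin r.N) (Fin r.N) ℂ) (g : G) :
    |(X * r.ρ g).trace.re| ≤ ∑ i, ∑ j, ‖X i j‖ := by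
  have hU := r.mem_unitary g
  calc |(X * r.ρ g).trace.re| ≤ ‖(X * r.ρ g).trace‖ := Complex.abs_re_le_norm _
    _ = ‖∑ i, ∑ j, X i j * r.ρ g j i‖ := by
        simp only [Matrix.trace, Matrix.diag_apply, Matrix.mul_apply]
    _ ≤ ∑ i, ‖∑ j, X i j * r.ρ g j i‖ := norm_sum_le _ _
    _ ≤ ∑ i, ∑ j, ‖X i j * r.ρ g j i‖ := Finset.sum_le_sum fun i _ => norm_sum_le _ _
    _ ≤ ∑ i, ∑ j, ‖X i j‖ := Finset.sum_le_sum fun i _ => Finset.sum_le_sum fun j _ => by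
        rw [norm_mul]
        exact mul_le_of_le_one_right (norm_nonneg _) (entry_norm_bound_of_unitary hU j i)

/-- Changing ONE variable inside a word: `|Re tr ρ(g₁ u g₂) − Re tr ρ(g₁ u' g₂)| ≤ repDist u u'`. -/
theorem abs_traceRe_word_sub_le (g₁ g₂ u u' : G) :
    |(r.ρ (g₁ * u * g₂)).trace.re - (r.ρ (g₁ * u' * g₂)).trace.re| ≤ repDist r u u' := by
  have h : (r.ρ (g₁ * u * g₂)).trace - (r.ρ (g₁ * u' * g₂)).trace =
      ((r.ρ u - r.ρ u') * r.ρ (g₂ * g₁)).trace := by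
    rw [← Matrix.trace_sub, map_mul, map_mul, map_mul, map_mul, map_mul, ← Matrix.sub_mul,
      ← Matrix.mul_sub, Matrix.trace_mul_cycle, ← Matrix.mul_assoc, Matrix.trace_mul_comm,
      Matrix.mul_assoc]
  rw [← Complex.sub_re, h]
  refine (abs_trace_re_mul_rep_le r _ _).trans (le_of_eq ?_)
  simp only [repDist, Matrix.sub_apply]

/-- The same for an inverted variable: `|Re tr ρ(g₁ u⁻¹ g₂) − Re tr ρ(g₁ u'⁻¹ g₂)| ≤ repDist u u'`
(`g₁ u⁻¹ g₂ = (g₁u⁻¹)·u'·(u'⁻¹g₂)` and `g₁ u'⁻¹ g₂ = (g₁u⁻¹)·u·(u'⁻¹g₂)`). -/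
theorem abs_traceRe_word_inv_sub_le (g₁ g₂ u u' : G) :
    |(r.ρ (g₁ * u⁻¹ * g₂)).trace.re - (r.ρ (g₁ * u'⁻¹ * g₂)).trace.re| ≤ repDist r u u' := by
  have h1 : g₁ * u⁻¹ * g₂ = (g₁ * u⁻¹) * u' * (u'⁻¹ * g₂) := by group
  have h2 : g₁ * u'⁻¹ * g₂ = (g₁ * u⁻¹) * u * (u'⁻¹ * g₂) := by group
  rw [h1, h2, abs_sub_comm]
  exact abs_traceRe_word_sub_le r _ _ u u'

variable {d L : ℕ}

/-- **Lipschitz bound of one plaquette cost** in its four link variables. -/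
theorem abs_plaquetteCost_sub_le [NeZero L] (U V : GaugeConfig d L G) (p : Plaquette d L) :
    |plaquetteCost r.ρ U p - plaquetteCost r.ρ V p| ≤
      repDist r (U (p.1, p.2.1.1)) (V (p.1, p.2.1.1)) +
        repDist r (U (p.1.shift p.2.1.1, p.2.1.2)) (V (p.1.shift p.2.1.1, p.2.1.2)) +
        repDist r (U (p.1.shift p.2.1.2, p.2.1.1)) (V (p.1.shift p.2.1.2, p.2.1.1)) +
        repDist r (U (p.1, p.2.1.2)) (V (p.1, p.2.1.2)) := by
  set a := U (p.1, p.2.1.1)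
  set b := U (p.1.shift p.2.1.1, p.2.1.2)
  set c := U (p.1.shift p.2.1.2, p.2.1.1)
  set e := U (p.1, p.2.1.2)
  set a' := V (p.1, p.2.1.1)
  set b' := V (p.1.shift p.2.1.1, p.2.1.2)
  set c' := V (p.1.shift p.2.1.2, p.2.1.1)
  set e' := V (p.1, p.2.1.2)
  have hU : plaquetteCost r.ρ U p = (r.N : ℝ) - (r.ρ (a * b * c⁻¹ * e⁻¹)).trace.re := rfl
  have hV : plaquetteCost r.ρ V p = (r.N : ℝ) - (r.ρ (a' * b' * c'⁻¹ * e'⁻¹)).trace.re := rfl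
  set T : G → ℝ := fun g => (r.ρ g).trace.re with hT
  have s1 : |T (a * b * c⁻¹ * e⁻¹) - T (a' * b * c⁻¹ * e⁻¹)| ≤ repDist r a a' := by
    have e1 : a * b * c⁻¹ * e⁻¹ = 1 * a * (b * c⁻¹ * e⁻¹) := by group
    have e2 : a' * b * c⁻¹ * e⁻¹ = 1 * a' * (b * c⁻¹ * e⁻¹) := by group
    simp only [hT]; rw [e1, e2]; exact abs_traceRe_word_sub_le r _ _ _ _
  have s2 : |T (a' * b * c⁻¹ * e⁻¹) - T (a' * b' * c⁻¹ * e⁻¹)| ≤ repDist r b b' := by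
    have e1 : a' * b * c⁻¹ * e⁻¹ = a' * b * (c⁻¹ * e⁻¹) := by group
    have e2 : a' * b' * c⁻¹ * e⁻¹ = a' * b' * (c⁻¹ * e⁻¹) := by group
    simp only [hT]; rw [e1, e2]; exact abs_traceRe_word_sub_le r _ _ _ _
  have s3 : |T (a' * b' * c⁻¹ * e⁻¹) - T (a' * b' * c'⁻¹ * e⁻¹)| ≤ repDist r c c' := by
    simp only [hT]; exact abs_traceRe_word_inv_sub_le r _ _ _ _
  have s4 : |T (a' * b' * c'⁻¹ * e⁻¹) - T (a' * b' * c'⁻¹ * e'⁻¹)| ≤ repDist r e e' := by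
    have e1 : a' * b' * c'⁻¹ * e⁻¹ = a' * b' * c'⁻¹ * e⁻¹ * 1 := by group
    have e2 : a' * b' * c'⁻¹ * e'⁻¹ = a' * b' * c'⁻¹ * e'⁻¹ * 1 := by group
    simp only [hT]; rw [e1, e2]; exact abs_traceRe_word_inv_sub_le r _ _ _ _
  rw [hU, hV, show ∀ x y : ℝ, (r.N : ℝ) - x - ((r.N : ℝ) - y) = y - x from fun x y => by ring,
    abs_sub_comm]
  calc |T (a * b * c⁻¹ * e⁻¹) - T (a' * b' * c'⁻¹ * e'⁻¹)|
      ≤ |T (a * b * c⁻¹ * e⁻¹) - T (a' * b * c⁻¹ * e⁻¹)| +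
          |T (a' * b * c⁻¹ * e⁻¹) - T (a' * b' * c⁻¹ * e⁻¹)| +
          |T (a' * b' * c⁻¹ * e⁻¹) - T (a' * b' * c'⁻¹ * e⁻¹)| +
          |T (a' * b' * c'⁻¹ * e⁻¹) - T (a' * b' * c'⁻¹ * e'⁻¹)| := by
        have t1 := abs_sub_le (T (a * b * c⁻¹ * e⁻¹)) (T (a' * b * c⁻¹ * e⁻¹)) (T (a' * b' * c'⁻¹ * e'⁻¹))
        have t2 := abs_sub_le (T (a' * b * c⁻¹ * e⁻¹)) (T (a' * b' * c⁻¹ * e⁻¹)) (T (a' * b' * c'⁻¹ * e'⁻¹))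
        have t3 := abs_sub_le (T (a' * b' * c⁻¹ * e⁻¹)) (T (a' * b' * c'⁻¹ * e⁻¹)) (T (a' * b' * c'⁻¹ * e'⁻¹))
        linarith
    _ ≤ _ := by linarith

/-- A plaquette cost reads only the four links `(x,i), (x+eᵢ,j), (x+eⱼ,i), (x,j)` of the
plaquette `(x, i<j)`. -/
theorem plaquetteCost_congr [NeZero L] {U V : GaugeConfig d L G} {p : Plaquette d L}
    (h1 : U (p.1, p.2.1.1) = V (p.1, p.2.1.1))
    (h2 : U (p.1.shift p.2.1.1, p.2.1.2) = V (p.1.shift p.2.1.1, p.2.1.2))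
    (h3 : U (p.1.shift p.2.1.2, p.2.1.1) = V (p.1.shift p.2.1.2, p.2.1.1))
    (h4 : U (p.1, p.2.1.2) = V (p.1, p.2.1.2)) : plaquetteCost r.ρ U p = plaquetteCost r.ρ V p := by
  simp only [plaquetteCost, plaquetteHolonomy, h1, h2, h3, h4]

/-- The shadow action of `B` reads only the links of the plaquettes based in `B`. -/
theorem shadowAction_congr [NeZero L] {B : Finset (Site d L)} {U V : GaugeConfig d L G}
    (h : ∀ p : Plaquette d L, p.1 ∈ B →
      U (p.1, p.2.1.1) = V (p.1, p.2.1.1) ∧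
        U (p.1.shift p.2.1.1, p.2.1.2) = V (p.1.shift p.2.1.1, p.2.1.2) ∧
        U (p.1.shift p.2.1.2, p.2.1.1) = V (p.1.shift p.2.1.2, p.2.1.1) ∧
        U (p.1, p.2.1.2) = V (p.1, p.2.1.2)) :
    shadowAction r.ρ B U = shadowAction r.ρ B V :=
  Finset.sum_congr rfl fun p hp => by
    obtain ⟨h1, h2, h3, h4⟩ := h p (Finset.mem_filter.1 hp).2
    exact plaquetteCost_congr r h1 h2 h3 h4

/-- If two configurations agree off `Y` and are `s`-close linkwise in `repDist`, their Wilson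
actions differ by at most `4 · #{plaquettes based in the shadow of Y} · s`. -/
theorem abs_wilsonAction_sub_le [NeZero L] {Y : Finset (Edge 4 L)} {U V : GaugeConfig 4 L G} {s : ℝ}
    (hUV : ∀ e ∉ Y, U e = V e) (hs : ∀ e, repDist r (U e) (V e) ≤ s) :
    |wilsonAction r.ρ U - wilsonAction r.ρ V| ≤
      4 * (Finset.univ.filter fun p : Plaquette 4 L => p.1 ∈ edgeShadow Y).card * s := by
  rw [wilsonAction_eq_shadowAction_add_bulkAction r.ρ (edgeShadow Y) U,
    wilsonAction_eq_shadowAction_add_bulkAction r.ρ (edgeShadow Y) V, bulkAction_congr r.ρ hUV,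
    add_sub_add_right_eq_sub]
  unfold shadowAction
  rw [← Finset.sum_sub_distrib]
  calc |∑ p ∈ Finset.univ.filter (fun p : Plaquette 4 L => p.1 ∈ edgeShadow Y),
          (plaquetteCost r.ρ U p - plaquetteCost r.ρ V p)|
      ≤ ∑ p ∈ Finset.univ.filter (fun p : Plaquette 4 L => p.1 ∈ edgeShadow Y),
          |plaquetteCost r.ρ U p - plaquetteCost r.ρ V p| := Finset.abs_sum_le_sum_abs _ _
    _ ≤ ∑ _p ∈ Finset.univ.filter (fun p : Plaquette 4 L => p.1 ∈ edgeShadow Y), 4 * s :=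
        Finset.sum_le_sum fun p _ => (abs_plaquetteCost_sub_le r U V p).trans
          (by linarith [hs (p.1, p.2.1.1), hs (p.1.shift p.2.1.1, p.2.1.2),
            hs (p.1.shift p.2.1.2, p.2.1.1), hs (p.1, p.2.1.2)])
    _ = _ := by rw [Finset.sum_const, nsmul_eq_mul]; ring

omit [TopologicalSpace G] in
/-- A gauge transformation trivial at the endpoints of a link does not move that link. -/
theorem gaugeTransform_apply_of_eq_one {g : Site d L → G} {U : GaugeConfig d L G}
    {e : Edge d L} (h1 : g e.1 = 1) (h2 : g (e.1.shift e.2) = 1) : gaugeTransform g U e = U e := by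
  simp [gaugeTransform, h1, h2]

end Rep

end SlabClustering

end

end Summit.QuantumFields.YangMills.Cruxes.LatticeGapOnTrajectory.OrbitKantorovichFiniteSize
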